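import Literature.AlgebraicGeometry.Motives.AbelianVarietyInducedActionMackey
import HarnessLib

/-!
# `Res_H Ind_H^G Y` for a MALNORMAL `H` (`H ∩ xHx⁻¹ = 1` for `x ∉ H`, Frobenius complements):
# `|H| · dim B_H(Res_H Ind_H^G Y) + dim Y = |H| · dim B_H(Y) + [G : H] · dim Y` and
# `B_H(Res_H Ind_H^G Y)^{|H|} × Y ∼ B_H(Y)^{|H|} × Y^{[G:H]}`

`X = ⊕_{t ∈ T} Y_t = Ind_H^G (Y, α)` (bicone `b`, `Σ_t π_t ≫ ι_t = 𝟙`; `ρ : G → End X`, `ι_t ρ(g) π_u = 0` for `u ≠ g t`; `T` transitive,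
`H = Stab(t₀)`, `α(h) = ι_{t₀} ρ(h) π_{t₀}`).  Mackey's `Res_H Ind_H^G W = ⊕_{s ∈ H\G/H} Ind_{H_s}^H W_s`, `H_s = sHs⁻¹ ∩ H` (Serre §7.4),
has `H_1 = H` and, when `H` is MALNORMAL — `H ∩ sHs⁻¹ = 1` for `s ∉ H`, i.e. no `h ≠ 1` of `H` fixes a point `x t₀ ≠ t₀` (Serre
Ex. 7.3: "`H` is a Frobenius subgroup of `G`") — all other `H_s` trivial, so `Res_H Ind_H^G W = W ⊕ (regular)^{([G:H]-1)/|H|}`.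
From the fixed-part formula of `Motives/AbelianVarietyInducedActionMackey` (`L = H`: the `x ∈ H` terms give `|H| Σ_h χ_Y(h)`, the
`x ∉ H` terms `χ_Y(1) = 2 dim Y` each) this file proves (theorems only, no definition):

* **`|H| · dim B_H(Res_H Ind_H^G Y) + dim Y = |H| · dim B_H(Y) + [G : H] · dim Y`** (any field; `B_H(X) = Im Σ_h ρ(h)`,
  `B_H(Y) = Im Σ_h α(h)`), its `rk_ℤ Hom(−, B)` form, and over a PERFECT field the isogeny
  **`B_H(Res_H Ind_H^G Y)^{|H|} × Y ∼ B_H(Y)^{|H|} × Y^{[G:H]}`**.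

## References

* [SerreLinearRepresentations1977] J.-P. Serre, *Linear Representations of Finite Groups*, GTM 42 (1977): §7.3 Prop. 22, §7.4
  (`H_s = sHs⁻¹ ∩ H`), Ex. 7.3 (Frobenius subgroups: `H ∩ tHt⁻¹ = {1}` for `t ∉ H`).  Held:
  `book:serre1977-linear-representations-finite-groups`, PDF pp. 52–54 read 2026-08-28.
* [KaniRosen1989] E. Kani, M. Rosen, *Idempotent relations and factors of Jacobians*, Math. Ann. 284 (1989), §3 Thm. B.
* [Milne1986AbelianVarieties] J. S. Milne, *Abelian Varieties* (1986), §12 (p. 122).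
* [MumfordAV1970] D. Mumford, *Abelian Varieties* (1970), §19 Thm. 3 (p. 176), Thm. 4 (p. 180).
-/

noncomputable section

open CategoryTheory CategoryTheory.Limits MulAction
open Literature.NumberTheory.DiophantineGeometry

universe u

namespace Literature.AlgebraicGeometry.Motives

namespace AbelianVariety

namespace Imprimitive

variable {K : Type u} [Field K]

section Malnormal

variable {Y : AbelianVariety K} (B : AbelianVariety K) {T : Type} [Fintype T] (b : Bicone (fun _ : T ↦ Y))
  {G : Type} [Group G] [Fintype G] [MulAction G T] [IsPretransitive G T] (ρ : G →* End b.pt) (t₀ : T)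
  [Fintype (stabilizer G t₀)] (α : stabilizer G t₀ →* End Y)

omit [Fintype T] [IsPretransitive G T] in
/-- The Mackey sum for `L = H` malnormal (private helper): if `x t₀ = t₀` every `h ∈ H` contributes `F h`; if `x t₀ ≠ t₀` only
`h = 1` does, so `Σ_x Σ_h [xhx⁻¹ ∈ H] F(h) = |H| • Σ_h F(h) + |{x : x t₀ ≠ t₀}| • F(1)`, and `|H| + |{x : x t₀ ≠ t₀}| = |G|`. [folklore] -/
private theorem sum_sum_ite_mem_stabilizer_eq [DecidablePred (· ∈ stabilizer G t₀)] [DecidableEq T]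
    (hTI : ∀ (x : G) (h : stabilizer G t₀), x • t₀ ≠ t₀ → (x * h * x⁻¹) • t₀ = t₀ → h = 1)
    {R : Type*} [AddCommMonoid R] (F : stabilizer G t₀ → R) :
    ∑ x : G, ∑ h : stabilizer G t₀, (if x * h * x⁻¹ ∈ stabilizer G t₀ then F h else 0) =
      Fintype.card (stabilizer G t₀) • ∑ h : stabilizer G t₀, F h +
        (Finset.univ.filter fun x : G ↦ ¬ x • t₀ = t₀).card • F 1 ∧
      Fintype.card (stabilizer G t₀) + (Finset.univ.filter fun x : G ↦ ¬ x • t₀ = t₀).card = Fintype.card G := by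
  have hcard : (Finset.univ.filter fun x : G ↦ x • t₀ = t₀).card = Fintype.card (stabilizer G t₀) := by
    rw [← Fintype.card_subtype]
    exact Fintype.card_congr (Equiv.subtypeEquivRight fun x ↦ (mem_stabilizer_iff (G := G)).symm)
  refine ⟨?_, ?_⟩
  · have hx : ∀ x : G, ∑ h : stabilizer G t₀, (if x * h * x⁻¹ ∈ stabilizer G t₀ then F h else 0) =
        if x • t₀ = t₀ then ∑ h : stabilizer G t₀, F h else F 1 := by
      intro x
      split_ifs with hx
      · have hxH : x ∈ stabilizer G t₀ := mem_stabilizer_iff.2 hx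
        exact Finset.sum_congr rfl fun h _ ↦ if_pos
          ((stabilizer G t₀).mul_mem ((stabilizer G t₀).mul_mem hxH h.2) ((stabilizer G t₀).inv_mem hxH))
      · rw [Finset.sum_eq_single (1 : stabilizer G t₀)
          (fun h _ hne ↦ if_neg fun hmem ↦ hne (hTI x h hx (mem_stabilizer_iff.1 hmem)))
          (fun h ↦ absurd (Finset.mem_univ _) h), if_pos]
        rw [OneMemClass.coe_one, mul_one, mul_inv_cancel]
        exact (stabilizer G t₀).one_mem
    rw [Finset.sum_congr rfl fun x _ ↦ hx x, Finset.sum_ite, Finset.sum_const, Finset.sum_const, hcard]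
  · rw [← hcard, Finset.card_filter_add_card_filter_not, Finset.card_univ]

/-- **Malnormal `H`: `|H| · dim B_H(Res_H Ind_H^G Y) + dim Y = |H| · dim B_H(Y) + [G : H] · dim Y`** (any field): if no `h ≠ 1`
of `H = Stab(t₀)` fixes a point `x t₀ ≠ t₀` (`H ∩ xHx⁻¹ = 1` for `x ∉ H` — `H` is a Frobenius complement / malnormal), then in
Mackey's decomposition `Res_H Ind_H^G W = ⊕_s Ind_{H_s}^H W_s` the double coset `H` contributes `W` and every other one a regular
representation, whence the dimension count (`B_H(X) = Im Σ_h ρ(h)`, `B_H(Y) = Im Σ_h α(h)`).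
[cite: SerreLinearRepresentations1977, §7.4 (`H_s = sHs⁻¹ ∩ H`) and Ex. 7.3] [cite: KaniRosen1989, §3 Thm. B] -/
theorem card_mul_dim_image_norm_restrict_add_eq_of_malnormal (hb : ∑ t, b.π t ≫ b.ι t = 𝟙 b.pt)
    (hρ : ∀ (g : G) (t u : T), g • t ≠ u → b.ι t ≫ End.asHom (ρ g) ≫ b.π u = 0)
    (hα : ∀ h : stabilizer G t₀, End.asHom (α h) = b.ι t₀ ≫ End.asHom (ρ h) ≫ b.π t₀)
    (hTI : ∀ (x : G) (h : stabilizer G t₀), x • t₀ ≠ t₀ → (x * h * x⁻¹) • t₀ = t₀ → h = 1)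
    {NH' : b.pt ⟶ b.pt} (hNH' : End.of NH' = ∑ h : stabilizer G t₀, ρ h)
    {NH : Y ⟶ Y} (hNH : End.of NH = ∑ h : stabilizer G t₀, α h) :
    Fintype.card (stabilizer G t₀) * (image NH').dim + Y.dim =
      Fintype.card (stabilizer G t₀) * (image NH).dim + (stabilizer G t₀).index * Y.dim := by
  classical
  obtain ⟨ℓ', hℓ'p, hℓ'⟩ := exists_prime_natCast_ne_zero (K := K)
  haveI : Fact ℓ'.Prime := ⟨hℓ'p⟩
  have h1 := card_stabilizer_mul_card_mul_two_mul_dim_image_norm_eq_sum ℓ' b ρ t₀ α (stabilizer G t₀) hb hρ hℓ' hα hNH'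
  obtain ⟨hsum, hcnt⟩ := sum_sum_ite_mem_stabilizer_eq t₀ hTI
    (fun h ↦ LinearMap.trace ℤ_[ℓ'] (Y.tateModule ℓ') (tateModuleMap ℓ' (End.asHom (α h))))
  have h2 := card_mul_two_mul_dim_image_normG_eq_sum_trace_tateModuleMap ℓ' α hNH hℓ'
  have h3 : LinearMap.trace ℤ_[ℓ'] (Y.tateModule ℓ') (tateModuleMap ℓ' (End.asHom (α 1))) = ((2 * Y.dim : ℕ) : ℤ_[ℓ']) := by
    rw [asHom_map_one_eq_id, trace_tateModuleMap_id_eq_two_mul_dim ℓ' Y hℓ']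
  rw [hsum, ← h2, h3, nsmul_eq_mul, nsmul_eq_mul, ← Nat.cast_mul, ← Nat.cast_mul, ← Nat.cast_add] at h1
  have h4 := Nat.cast_injective (R := ℤ_[ℓ']) h1
  set c := (Finset.univ.filter fun x : G ↦ ¬ x • t₀ = t₀).card with hc
  have hG : Fintype.card G = (stabilizer G t₀).index * Fintype.card (stabilizer G t₀) := by
    rw [← Nat.card_eq_fintype_card, ← Nat.card_eq_fintype_card, Subgroup.index_mul_card]
  refine Nat.eq_of_mul_eq_mul_left (mul_pos two_pos (Fintype.card_pos (α := stabilizer G t₀))) ?_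
  calc 2 * Fintype.card (stabilizer G t₀) * (Fintype.card (stabilizer G t₀) * (image NH').dim + Y.dim)
      = Fintype.card (stabilizer G t₀) * (Fintype.card (stabilizer G t₀) * (2 * (image NH').dim)) +
          Fintype.card (stabilizer G t₀) * (2 * Y.dim) := by ring
    _ = Fintype.card (stabilizer G t₀) * (Fintype.card (stabilizer G t₀) * (2 * (image NH).dim)) + c * (2 * Y.dim) +
          Fintype.card (stabilizer G t₀) * (2 * Y.dim) := by rw [h4]
    _ = Fintype.card (stabilizer G t₀) * (Fintype.card (stabilizer G t₀) * (2 * (image NH).dim)) +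
          (Fintype.card (stabilizer G t₀) + c) * (2 * Y.dim) := by ring
    _ = 2 * Fintype.card (stabilizer G t₀) *
          (Fintype.card (stabilizer G t₀) * (image NH).dim + (stabilizer G t₀).index * Y.dim) := by
        rw [hcnt, hG]; ring

/-- **Malnormal `H`, `Hom` form: `|H| · rk_ℤ Hom(B_H(Res_H Ind_H^G Y), B) + rk_ℤ Hom(Y, B) = |H| · rk_ℤ Hom(B_H(Y), B) + [G : H] · rk_ℤ Hom(Y, B)`**
for every abelian variety `B` (any field). [cite: SerreLinearRepresentations1977, §7.4 and Ex. 7.3] [cite: KaniRosen1989, §2 and §3 Thm. B] -/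
theorem card_mul_finrank_hom_image_norm_restrict_add_eq_of_malnormal (hb : ∑ t, b.π t ≫ b.ι t = 𝟙 b.pt)
    (hρ : ∀ (g : G) (t u : T), g • t ≠ u → b.ι t ≫ End.asHom (ρ g) ≫ b.π u = 0)
    (hα : ∀ h : stabilizer G t₀, End.asHom (α h) = b.ι t₀ ≫ End.asHom (ρ h) ≫ b.π t₀)
    (hTI : ∀ (x : G) (h : stabilizer G t₀), x • t₀ ≠ t₀ → (x * h * x⁻¹) • t₀ = t₀ → h = 1)
    {NH' : b.pt ⟶ b.pt} (hNH' : End.of NH' = ∑ h : stabilizer G t₀, ρ h)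
    {NH : Y ⟶ Y} (hNH : End.of NH = ∑ h : stabilizer G t₀, α h) :
    Fintype.card (stabilizer G t₀) * Module.finrank ℤ (image NH' ⟶ B) + Module.finrank ℤ (Y ⟶ B) =
      Fintype.card (stabilizer G t₀) * Module.finrank ℤ (image NH ⟶ B) + (stabilizer G t₀).index * Module.finrank ℤ (Y ⟶ B) := by
  classical
  haveI : Module.Free ℤ (Y ⟶ B) := module_free_hom_holds Y B
  haveI : Module.Finite ℤ (Y ⟶ B) := module_finite_hom_holds Y B
  have h1 := card_stabilizer_mul_card_mul_finrank_hom_image_norm_eq_sum B b ρ t₀ α (stabilizer G t₀) hb hρ hα hNH'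
  obtain ⟨hsum, hcnt⟩ := sum_sum_ite_mem_stabilizer_eq t₀ hTI
    (fun h ↦ LinearMap.trace ℤ (Y ⟶ B) (Preadditive.leftComp B (End.asHom (α h))).toIntLinearMap)
  -- `|H| · rk Hom(B_H(Y), B) = Σ_h χ_B(α(h))`
  have hNH1 : NH = ∑ h : stabilizer G t₀, (1 : ℤ) • End.asHom (α h) := by
    rw [Finset.sum_congr rfl fun (h : stabilizer G t₀) _ ↦ one_zsmul (End.asHom (α h))]; exact hNH
  have h2 : ∑ h : stabilizer G t₀, LinearMap.trace ℤ (Y ⟶ B) (Preadditive.leftComp B (End.asHom (α h))).toIntLinearMap =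
      ((Fintype.card (stabilizer G t₀) * Module.finrank ℤ (image NH ⟶ B) : ℕ) : ℤ) := by
    rw [Nat.cast_mul, ← trace_leftComp_eq_mul_finrank B (normG_comp_normG_eq_card_nsmul α hNH)]
    conv_rhs => rw [hNH1]
    rw [trace_leftComp_sum_zsmul]
    exact Finset.sum_congr rfl fun h _ ↦ (one_mul _).symm
  have hid : (Preadditive.leftComp B (𝟙 Y)).toIntLinearMap = LinearMap.id := LinearMap.ext fun f ↦ Category.id_comp f
  have h3 : LinearMap.trace ℤ (Y ⟶ B) (Preadditive.leftComp B (End.asHom (α 1))).toIntLinearMap =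
      (Module.finrank ℤ (Y ⟶ B) : ℤ) := by
    rw [asHom_map_one_eq_id, hid, LinearMap.trace_id]
  rw [hsum, h2, h3, nsmul_eq_mul, nsmul_eq_mul, ← Nat.cast_mul, ← Nat.cast_mul, ← Nat.cast_add] at h1
  have h4 := Nat.cast_injective (R := ℤ) h1
  set c := (Finset.univ.filter fun x : G ↦ ¬ x • t₀ = t₀).card with hc
  have hG : Fintype.card G = (stabilizer G t₀).index * Fintype.card (stabilizer G t₀) := by
    rw [← Nat.card_eq_fintype_card, ← Nat.card_eq_fintype_card, Subgroup.index_mul_card]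
  refine Nat.eq_of_mul_eq_mul_left (Fintype.card_pos (α := stabilizer G t₀)) ?_
  calc Fintype.card (stabilizer G t₀) *
        (Fintype.card (stabilizer G t₀) * Module.finrank ℤ (image NH' ⟶ B) + Module.finrank ℤ (Y ⟶ B))
      = Fintype.card (stabilizer G t₀) * (Fintype.card (stabilizer G t₀) * Module.finrank ℤ (image NH' ⟶ B)) +
          Fintype.card (stabilizer G t₀) * Module.finrank ℤ (Y ⟶ B) := by ring
    _ = Fintype.card (stabilizer G t₀) * (Fintype.card (stabilizer G t₀) * Module.finrank ℤ (image NH ⟶ B)) +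
          c * Module.finrank ℤ (Y ⟶ B) + Fintype.card (stabilizer G t₀) * Module.finrank ℤ (Y ⟶ B) := by rw [h4]
    _ = Fintype.card (stabilizer G t₀) * (Fintype.card (stabilizer G t₀) * Module.finrank ℤ (image NH ⟶ B)) +
          (Fintype.card (stabilizer G t₀) + c) * Module.finrank ℤ (Y ⟶ B) := by ring
    _ = Fintype.card (stabilizer G t₀) *
          (Fintype.card (stabilizer G t₀) * Module.finrank ℤ (image NH ⟶ B) +
            (stabilizer G t₀).index * Module.finrank ℤ (Y ⟶ B)) := by
        rw [hcnt, hG]; ring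

/-- **Malnormal `H`, up to isogeny over a perfect field: `B_H(Res_H Ind_H^G Y)^{|H|} × Y ∼ B_H(Y)^{|H|} × Y^{[G:H]}`**
("`Res_H Ind_H^G W ≅ W ⊕ (ℤ[H] ⊗ W)^{([G:H]-1)/|H|}`" for a Frobenius complement `H`; both sides have equal `rk Hom(−, B)` for every
`B`). [cite: SerreLinearRepresentations1977, §7.4 and Ex. 7.3] [cite: KaniRosen1989, §3 Thm. B] [cite: Milne1986AbelianVarieties, §12 p. 122] -/
theorem isIsogenous_image_norm_restrict_biprod_of_malnormal [PerfectField K] (hb : ∑ t, b.π t ≫ b.ι t = 𝟙 b.pt)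
    (hρ : ∀ (g : G) (t u : T), g • t ≠ u → b.ι t ≫ End.asHom (ρ g) ≫ b.π u = 0)
    (hα : ∀ h : stabilizer G t₀, End.asHom (α h) = b.ι t₀ ≫ End.asHom (ρ h) ≫ b.π t₀)
    (hTI : ∀ (x : G) (h : stabilizer G t₀), x • t₀ ≠ t₀ → (x * h * x⁻¹) • t₀ = t₀ → h = 1)
    {NH' : b.pt ⟶ b.pt} (hNH' : End.of NH' = ∑ h : stabilizer G t₀, ρ h)
    {NH : Y ⟶ Y} (hNH : End.of NH = ∑ h : stabilizer G t₀, α h) :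
    IsIsogenous ((⨁ fun _ : Fin (Fintype.card (stabilizer G t₀)) ↦ image NH') ⊞ Y)
      ((⨁ fun _ : Fin (Fintype.card (stabilizer G t₀)) ↦ image NH) ⊞ (⨁ fun _ : Fin (stabilizer G t₀).index ↦ Y)) := by
  refine isIsogenous_iff_forall_finrank_hom_eq'.2 fun B ↦ ?_
  rw [finrank_hom_biprod, finrank_hom_biprod, finrank_hom_biproduct_const, finrank_hom_biproduct_const,
    finrank_hom_biproduct_const, Fintype.card_fin, Fintype.card_fin]
  exact card_mul_finrank_hom_image_norm_restrict_add_eq_of_malnormal B b ρ t₀ α hb hρ hα hTI hNH' hNH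

end Malnormal

end Imprimitive

end AbelianVariety

end Literature.AlgebraicGeometry.Motives
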